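import Summits.AtomisticToContinuum.BoseEinsteinCondensation.Theorems.BECGroundStateSOSPeriodicIRBoundTwoSectorFloatingDefs
import Summits.AtomisticToContinuum.BoseEinsteinCondensation.Theorems.BECGroundStateSOSPeriodicIRBoundTwoSectorWindow
import HarnessLib

/-!
# Route `BECGroundStateSOS`, crux `PeriodicIRBound` (stmt-AtomisticToContinuum-3972), line `two-sector-gd-transfer`
# (v7 "floating thresholds") — stub S5' `stub_windowAssemblyT : WindowAssemblyT`

Supports (does not close) stmt-AtomisticToContinuum-3972. The registered stub S5' of the v7 skeleton
`Cruxes/PeriodicIRBound/Lines/two_sector_gd_transfer.lean` (statement `WindowAssemblyT` in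
`Theorems/BECGroundStateSOSPeriodicIRBoundTwoSectorFloatingDefs.lean`): for ONE integrable admissible potential `v`, the
floating two-channel bound `FloatingFor v K ρ₀ C` (for every `ε > 0` and `ρ < ρ₀`, eventually in `N = m + 2` along
`L = L_N(ρ)`, at every mode `0 < 2π‖n‖_∞/L ≤ K` there are `μ₊ ≥ 0`, `μ₋ ≤ μ₊ + ε√(ρa)/L` with the particle channel
`ChanPlus` against the threshold `E₀(N) + μ₊` and the hole channel `ChanMinus` against `E₀(N) − μ₋`, both with bound
`b = CL²/‖n‖²_∞`) and the free-threshold Kennedy–Lieb–Shastry moment inequality `KLSMomentForT v` give the crux's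
infrared inequality `IRBoundFor v`.

Proof (the landed S5 proof `stub_windowAssembly`, p138491, with the convexity extraction replaced by the hypothesis).
Fix `κ > 0`; put `ρ₀' := min ρ₀ ((K/(2πκ))²)` and `C' := C√a + 2κ + √((12π²C + 1)κ² + 2C‖v‖₁)` (`a` the scattering
length, `‖v‖₁ = ∫ v(|x|)dx`). For `ρ < ρ₀'` a window mode `0 < ‖n‖_∞ ≤ κ√ρL` has `2π‖n‖_∞/L ≤ 2πκ√ρ ≤ K`, so
`FloatingFor` (at `ε = 1`, eventually in `m`, read eventually in `N = m + 2`) supplies `(μ₊, μ₋)` and the two channel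
inequalities at `b = CL²/‖n‖²`; `E₀(N, L) < ⊤` for integrable `v`
(`ZeroMomentumGround.periodicGroundStateEnergy_ne_top_of_lintegral_ne_top`), and `KLSMomentForT` at thresholds
`Tp := E₀(N) + μ₊`, `Tm := E₀(N) − μ₋` and `η_n := min 1 (‖n‖²/(CL²))` (so `bη_n ≤ 1`) yields a slack `δ(n) > 0`; the
slack `δ_N` of the crux is the least `δ(n)` over the finite box containing the window (`Negative.inWindow_mem_box`).
For a `δ_N`-near-minimiser `Ψ` the energy combination of the moment inequality is
`E₀(N)(2n_k+1) − (E₀(N) − μ₋)n_k − (E₀(N) + μ₊)(n_k+1) = (μ₋ − μ₊)n_k − μ₊ ≤ n_k·√(ρa)/L`, which is exactly the input of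
the landed endgame `WindowArith.nk_le` with `e3 := E₀(N) + μ₊`, `e1 := E₀(N) − μ₋` (`hmono : e0 ≤ e0 + μ₊`,
`hconv : 2e0 ≤ (e0 + μ₊) + (e0 − μ₋) + √(ρa)/L`), `D ≤ 12π²‖n‖²/L² + 2ρ‖v‖₁` (`|2πn/L|² ≤ 12π²‖n‖²_∞/L²`,
`TransferArith.norm_latticeVec_eq`, `L³ = N/ρ`): `n_k ≤ C'·√ρL/‖n‖`. Elementary (real/`ℝ≥0∞` arithmetic and filters);
no convexity of `N ↦ E₀(N, L)` anywhere; nothing is cited as a fact. References for the shape only: T. Kennedy,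
E. H. Lieb, B. S. Shastry, J. Stat. Phys. 53 (1988) 1019, (12)–(14).
-/

noncomputable section

open scoped BigOperators ENNReal
open Filter MeasureTheory

namespace Summit.AtomisticToContinuum.BoseEinsteinCondensation.Cruxes.PeriodicIRBound.TwoSectorGdTransfer

open Literature.MathematicalPhysics.QuantumManyBody.BoseGas
open Summit.AtomisticToContinuum.BoseEinsteinCondensation.Theorems.PeriodicIRBound.Negative
  (IRBoundFor NearMin InWindow IRIneq irIneq_iff inWindow_mem_box sqrt_nsq_le_sqrt_three_mul_norm)
open Summit.AtomisticToContinuum.BoseEinsteinCondensation.Theorems.GaussianDominationCan.Negative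
  (nsq nsq_nonneg one_le_norm_intVec)
open Summit.AtomisticToContinuum.BoseEinsteinCondensation.Cruxes.PeriodicIRBound.LinearPhFloorWagner
  (TransferArith.norm_latticeVec_eq WF.periodicGroundStateEnergy_le_succ)
open Summit.AtomisticToContinuum.BoseEinsteinCondensation.Theorems.ZeroMomentumGround
  (periodicGroundStateEnergy_ne_top_of_lintegral_ne_top)

/-! ### The stub -/

/-- **Stub S5' — window arithmetic and the scalar endgame, floating thresholds.** For an integrable admissible `v`,
the floating two-channel bound with data `(K, ρ₀, C)` and the free-threshold fixed-`(N, L)` KLS moment inequality give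
the crux's infrared inequality for `v`: for `κ > 0`, densities below `min ρ₀ ((K/(2πκ))²)` and constant
`C√a + 2κ + √((12π²C+1)κ² + 2C‖v‖₁)`, eventually in `N` the least KLS slack over the finite momentum window works
(see the module docstring for the proof). [folklore] -/
theorem stub_windowAssemblyT : WindowAssemblyT := by
  intro v hv hint K ρ₀ C hK hρ₀ hC hF hKLS κ hκ
  set V₁ : ℝ := (∫⁻ x : Space, v ‖x‖).toReal with hV₁def
  set a : ℝ := (scatteringLength v).toReal with hadef
  have hV₁ : 0 ≤ V₁ := ENNReal.toReal_nonneg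
  refine ⟨min ρ₀ ((K / (2 * Real.pi * κ)) ^ 2), by positivity,
    C * Real.sqrt a + 2 * κ + Real.sqrt ((12 * Real.pi ^ 2 * C + 1) * κ ^ 2 + 2 * C * V₁), by positivity,
    fun ρ hρ hρlt => ?_⟩
  set C' : ℝ := C * Real.sqrt a + 2 * κ + Real.sqrt ((12 * Real.pi ^ 2 * C + 1) * κ ^ 2 + 2 * C * V₁) with hC'
  have hρ1 : ρ < ρ₀ := hρlt.trans_le (min_le_left _ _)
  have hρ3 : ρ < (K / (2 * Real.pi * κ)) ^ 2 := hρlt.trans_le (min_le_right _ _)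
  -- the window fits under `K`: `2πκ√ρ ≤ K`
  have hKρ : 2 * Real.pi * κ * Real.sqrt ρ ≤ K := by
    have h1 : Real.sqrt ρ < K / (2 * Real.pi * κ) := (Real.sqrt_lt' (by positivity)).2 hρ3
    calc 2 * Real.pi * κ * Real.sqrt ρ ≤ 2 * Real.pi * κ * (K / (2 * Real.pi * κ)) :=
          mul_le_mul_of_nonneg_left h1.le (by positivity)
      _ = K := by field_simp
  -- the floating two-channel bound at `ε = 1`, eventually in `m`, read eventually in `N = m + 2`
  obtain ⟨m₀, hm₀⟩ := eventually_atTop.1 (hF 1 one_pos ρ hρ hρ1)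
  refine eventually_atTop.2 ⟨m₀ + 2, fun N hN => ?_⟩
  obtain ⟨m, rfl⟩ : ∃ m, N = m + 2 := ⟨N - 2, by omega⟩
  have hFm := hm₀ m (by omega)
  -- notation and side conditions along `L = L_N(ρ)`, `L³ = N/ρ`
  have hL : 0 < sideLength ρ (m + 2) := sideLength_pos_of_pos hρ (by omega)
  have hL3 : sideLength ρ (m + 2) ^ 3 = ((m + 2 : ℕ) : ℝ) / ρ := sideLength_pow_three hρ (m + 2)
  set L := sideLength ρ (m + 2) with hLdef
  have hfin : ∀ M : ℕ, periodicGroundStateEnergy v M L ≠ ⊤ := fun M =>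
    periodicGroundStateEnergy_ne_top_of_lintegral_ne_top hv.1 hint M hL
  have he0 : 0 ≤ 1 * Real.sqrt (ρ * a) / L := by positivity
  have he : 1 * Real.sqrt (ρ * a) / L ≤ Real.sqrt ρ * Real.sqrt a / L := by
    rw [one_mul, Real.sqrt_mul hρ.le]
  -- a slack for each mode of the window
  have hk : ∀ n : Fin 3 → ℤ, ∃ δ : ℝ≥0∞, 0 < δ ∧ (InWindow κ ρ (m + 2) n →
      ∀ Ψ : PeriodicTrialState (m + 2) L, NearMinAt v δ Ψ → IRIneq C' ρ (m + 2) Ψ.ψ n) := by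
    intro n
    by_cases hnw : InWindow κ ρ (m + 2) n
    · have hn1 : 1 ≤ ‖(fun j => (n j : ℝ))‖ := one_le_norm_intVec hnw.1
      have hnL : ‖(fun j => (n j : ℝ))‖ ≤ κ * Real.sqrt ρ * L := hnw.2
      set nn : ℝ := ‖(fun j => (n j : ℝ))‖ with hnn
      have hn0 : 0 < nn := one_pos.trans_le hn1
      have hc : 0 < 2 * Real.pi / L := by positivity
      have hnK : 2 * Real.pi / L * nn ≤ K := by
        calc 2 * Real.pi / L * nn ≤ 2 * Real.pi / L * (κ * Real.sqrt ρ * L) :=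
              mul_le_mul_of_nonneg_left hnL hc.le
          _ = 2 * Real.pi * κ * Real.sqrt ρ := by field_simp
          _ ≤ K := hKρ
      have hb : 0 ≤ C * L ^ 2 / nn ^ 2 := by positivity
      -- the floating thresholds `e0 + μp`, `e0 - μm` and the two channel inequalities at this mode
      obtain ⟨μp, μm, hμp, hμm, hCP, hCM⟩ := hFm n hnw.1 hnK
      have hη : 0 < min 1 (nn ^ 2 / (C * L ^ 2)) := lt_min one_pos (by positivity)
      obtain ⟨δ, hδ, hδspec⟩ := hKLS m L hL (hfin _) n hnw.1 _ hb _ _ hCP hCM _ hη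
      refine ⟨δ, hδ, fun _ Ψ hΨ => ?_⟩
      have hocc : cellOccupation (m + 2) L (planeWaveMode L n) Ψ.ψ ≠ ⊤ :=
        ne_top_of_le_ne_top (ENNReal.natCast_ne_top _) (Ψ.cellOccupation_planeWaveMode_le hL n)
      have hbη : C * L ^ 2 / nn ^ 2 * min 1 (nn ^ 2 / (C * L ^ 2)) ≤ 1 := by
        calc C * L ^ 2 / nn ^ 2 * min 1 (nn ^ 2 / (C * L ^ 2))
            ≤ C * L ^ 2 / nn ^ 2 * (nn ^ 2 / (C * L ^ 2)) := mul_le_mul_of_nonneg_left (min_le_right _ _) hb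
          _ = 1 := by field_simp
      have hD0 : 0 ≤ ‖latticeVec (2 * Real.pi / L) n‖ ^ 2 + 2 * ((m : ℝ) + 2) * V₁ / L ^ 3 := by
        positivity
      have hD : ‖latticeVec (2 * Real.pi / L) n‖ ^ 2 + 2 * ((m : ℝ) + 2) * V₁ / L ^ 3 ≤
          12 * Real.pi ^ 2 * nn ^ 2 / L ^ 2 + 2 * ρ * V₁ := by
        have h1 : ‖latticeVec (2 * Real.pi / L) n‖ ^ 2 ≤ 12 * Real.pi ^ 2 * nn ^ 2 / L ^ 2 := by
          rw [TransferArith.norm_latticeVec_eq, abs_of_pos hc]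
          have h3 : Real.sqrt (nsq n) ≤ Real.sqrt 3 * nn := sqrt_nsq_le_sqrt_three_mul_norm n
          calc (2 * Real.pi / L * Real.sqrt (nsq n)) ^ 2 ≤ (2 * Real.pi / L * (Real.sqrt 3 * nn)) ^ 2 :=
                pow_le_pow_left₀ (by positivity) (mul_le_mul_of_nonneg_left h3 hc.le) 2
            _ = 12 * Real.pi ^ 2 * nn ^ 2 / L ^ 2 := by
                rw [mul_pow, mul_pow, Real.sq_sqrt (by norm_num : (0 : ℝ) ≤ 3)]
                field_simp
                ring
        have h2 : 2 * ((m : ℝ) + 2) * V₁ / L ^ 3 = 2 * ρ * V₁ := by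
          have hm : (m : ℝ) + 2 ≠ 0 := by positivity
          rw [hL3]
          push_cast
          field_simp
        linarith
      -- the floating thresholds replace monotonicity and midpoint near-convexity
      have hμm' : μm ≤ μp + 1 * Real.sqrt (ρ * a) / L := hμm
      have hmono : (periodicGroundStateEnergy v (m + 2) L).toReal ≤
          (periodicGroundStateEnergy v (m + 2) L).toReal + μp := by linarith
      have hconvR : 2 * (periodicGroundStateEnergy v (m + 2) L).toReal ≤
          ((periodicGroundStateEnergy v (m + 2) L).toReal + μp) +
            ((periodicGroundStateEnergy v (m + 2) L).toReal - μm) + 1 * Real.sqrt (ρ * a) / L := by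
        linarith
      have hkls := hδspec Ψ hΨ
      rw [← hV₁def] at hkls
      have key := WindowArith.nk_le hC hκ hρ hL hn1 hnL hV₁ hη.le (min_le_left _ _) hbη hD0 hD
        ENNReal.toReal_nonneg he0 he hmono hconvR hkls
      rw [irIneq_iff]
      exact (ENNReal.ofReal_toReal hocc).symm.le.trans (ENNReal.ofReal_le_ofReal key)
    · exact ⟨1, one_pos, fun h => (hnw h).elim⟩
  choose δf hδf hprop using hk
  -- the least slack over the finite box containing the window
  set W : Finset (Fin 3 → ℤ) := Fintype.piFinset fun _ : Fin 3 =>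
      Finset.Icc (-((⌈κ * Real.sqrt ρ * L⌉₊ : ℕ) : ℤ)) ((⌈κ * Real.sqrt ρ * L⌉₊ : ℕ) : ℤ) with hW
  have hW0 : (0 : Fin 3 → ℤ) ∈ W := by
    rw [hW, Fintype.mem_piFinset]
    intro j
    simp
  have hWne : W.Nonempty := ⟨0, hW0⟩
  refine ⟨W.inf' hWne δf, (Finset.lt_inf'_iff hWne).2 fun k _ => hδf k, fun Ψ hΨ k hkw => ?_⟩
  have hmem : k ∈ W := inWindow_mem_box hkw
  exact hprop k hkw Ψ (hΨ.trans (add_le_add le_rfl (Finset.inf'_le _ hmem)))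

end Summit.AtomisticToContinuum.BoseEinsteinCondensation.Cruxes.PeriodicIRBound.TwoSectorGdTransfer

end
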